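import Mathlib
import Literature.Computability.AlgebraicComplexity.OrbitCoordinateRingProofs
import Literature.Computability.AlgebraicComplexity.PlethysmStability
import Literature.Computability.Complexity.OccurrenceObstructionsBIP
import Summits.ValiantsHypothesis.ValiantsHypothesis.Theorems.ValuativeGCTValuativeFlipNoSmallBodyEquations
import Summits.ValiantsHypothesis.ValiantsHypothesis.Theorems.ValuativeGCTValuativeFlipBouquetCriterion

/-!
# Equations of `Det_m` are divisible by high powers of the top coordinate

Wall-breaker axis D (det-orbit-closure multiplicity bounds) for crux `ValuativeGCT.ValuativeFlip`
(stmt-ValiantsHypothesis-12624): the structural consequence of the bouquet criterion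
(`…BouquetCriterion`) BEYOND body `m + 1`.

Fix a base letter `i₀` and let `X_{d₀}`, `d₀ = m·e_{i₀}`, be the coordinate "coefficient of `x_{i₀}^m`".
A monomial `∏ X_d^{s d}` of degree `D` and body `b = ∑_d s(d) (m - d i₀)` that is NOT divisible by
`X_{d₀}` has `D` body factors, so its bouquet budget is `1 + ∑_{d ∈ supp s} (m - d i₀ - 1) ≤ 1 + b - D`;
hence if `D ≥ b - m + 1` every monomial of an equation of `Det_m` (bihomogeneous of bidegree `(D, b)`)
is divisible by `X_{d₀}`, the quotient is again an equation (the ideal is prime and `X_{d₀}` is not an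
equation), of bidegree `(D - 1, b)`, and we may iterate:

* `X_pow_dvd_of_mem_orbitVanishingIdeal_detFormLex` — **every equation `F` of `Δ(det_m)` all of whose
  monomials have degree `D` and body `b` is divisible by `X_{d₀}^(D + m - b)`.**  Equivalently: modulo
  multiplication by `X_{d₀}`, the equations of `Det_m` of body `b` are all BORN IN DEGREE `≤ b - m`;
  a new equation of type `λ = (λ₁; λ̄)` in degree `δ` needs `λ₁ ≤ (m - 1)(δ - 1) - 1`
  (Landsberg–Manivel–Ressayre's equations, `δ = 2m(m-1)`, `λ₁ = 2m³ - 4m² + 1 ≤ 2m³ - 4m² + m`, satisfy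
  this with slack `m - 1` only).
* `finrank_equations_detFormLex_eq_of_le` — with `i₀ = iₘ` the top letter (where `X_{d₀}` is a
  highest-weight vector of weight `w₀ = -m ε_{iₘ}`), multiplication by `X_{d₀}` is a bijection between the
  highest-weight equations of weights `χ - w₀` and `χ` as soon as `D ≥ b - m + 1` (`|χ| = -mD`,
  `b = mD + χ iₘ`), so the EQUATION COUNT `e(χ) = a(χ) - K_m(χ)` (plethysm coefficient minus
  det-orbit-closure multiplicity) is constant along `χ ↦ χ + w₀` from degree `b - m` on:
  `plethysmCoeff χ - K_m χ = plethysmCoeff (χ - w₀) - K_m (χ - w₀)`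
  (`plethysmCoeff_sub_orbitMultiplicity_detFormLex_eq`).  In partition language: for fixed `λ̄` of size
  `b`, `a_{(mδ-b; λ̄)}(δ[m]) - K_m((mδ-b; λ̄)*)` does not depend on `δ ≥ b - m`.

Characteristic zero; no definitions. [new]
-/

set_option linter.dupNamespace false

namespace Summit.ValiantsHypothesis.ValiantsHypothesis.Theorems.ValuativeFlip

open MvPolynomial
open scoped BigOperators Matrix
open Literature.NumberTheory.DiophantineGeometry
open Literature.Computability.AlgebraicComplexity
open Literature.Computability.Complexity

noncomputable section

/-- The top coordinate `X_{d₀}` (`d₀ = m·e_{i₀}`) is not an equation of `Δ(det_m)`: the bouquet with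
no petals, `A · det_m = x_{i₀}^m`. [new, elementary] -/
theorem X_single_not_mem_orbitVanishingIdeal_detFormLex {k : Type*} [Field k] [CharZero k] {m : ℕ}
    (i₀ : MatIdx m) (d₀ : DegIdx (MatIdx m) m) (hd₀ : d₀.1 = Finsupp.single i₀ m) :
    (X d₀ : MvPolynomial (DegIdx (MatIdx m) m) k) ∉ orbitVanishingIdeal (detFormLex k m) m := by
  classical
  have hm : 0 < m := Fin.pos (ofLex i₀).1
  refine not_mem_orbitVanishingIdeal_detFormLex_of_bouquet i₀ (isHomogeneous_X k d₀)
    (s := Finsupp.single d₀ 1) (by rw [support_X]; exact Finset.mem_singleton_self _) ?_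
  rw [Finsupp.support_single _ one_ne_zero, Finset.sum_singleton, hd₀, Finsupp.single_eq_same]
  omega

/-- The body functional `s ↦ ∑_d s(d) (m - d i₀)` is additive. [folklore] -/
theorem bq_bodySum_add {m : ℕ} (i₀ : MatIdx m) (s s' : DegIdx (MatIdx m) m →₀ ℕ) :
    ((s + s').sum fun d n => n * (m - d.1 i₀)) =
      (s.sum fun d n => n * (m - d.1 i₀)) + (s'.sum fun d n => n * (m - d.1 i₀)) :=
  Finsupp.sum_add_index' (fun _ => zero_mul _) (fun _ _ _ => add_mul _ _ _)

/-- **Equations of `Det_m` are divisible by high powers of the top coordinate.**  Let `F` be an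
equation of `Δ(det_m)` (`F ∈ orbitVanishingIdeal`) all of whose monomials have degree `D` and body
`∑_d s(d) (m - d i₀) = b` (e.g. a torus weight vector).  Then `X_{d₀}^(D + m - b) ∣ F`, `d₀ = m·e_{i₀}`:
a monomial not divisible by `X_{d₀}` would meet the bouquet budget as soon as `D ≥ b - m + 1`
(`not_mem_orbitVanishingIdeal_detFormLex_of_bouquet`), the quotient by `X_{d₀}` is again an equation
(`orbitVanishingIdeal_isPrime`, `X_single_not_mem_orbitVanishingIdeal_detFormLex`) of bidegree
`(D - 1, b)`, and we induct on `D`.  Registered sub-goal of the crux (wall-breaker k7, axis D). [new] -/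
theorem X_pow_dvd_of_mem_orbitVanishingIdeal_detFormLex {k : Type*} [Field k] [CharZero k] {m : ℕ}
    (i₀ : MatIdx m) (d₀ : DegIdx (MatIdx m) m) (hd₀ : d₀.1 = Finsupp.single i₀ m) (b D : ℕ)
    (F : MvPolynomial (DegIdx (MatIdx m) m) k) (hdeg : ∀ s ∈ F.support, s.degree = D)
    (hbody : ∀ s ∈ F.support, (s.sum fun d n => n * (m - d.1 i₀)) = b)
    (hI : F ∈ orbitVanishingIdeal (detFormLex k m) m) :
    (X d₀ : MvPolynomial (DegIdx (MatIdx m) m) k) ^ (D + m - b) ∣ F := by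
  classical
  have hm : 0 < m := Fin.pos (ofLex i₀).1
  have hdegd : ∀ d : DegIdx (MatIdx m) m, d.1.degree = m := fun d => mem_degMonomials_iff.mp d.2
  have hle : ∀ d : DegIdx (MatIdx m) m, d.1 i₀ ≤ m := fun d => by
    have h1 := degree_eq_degree_subtypeDomain_add i₀ d.1
    have h2 := hdegd d
    omega
  -- a factor with `d i₀ = m` is `d₀`
  have htop : ∀ d : DegIdx (MatIdx m) m, d.1 i₀ = m → d = d₀ := by
    intro d hd
    apply Subtype.ext
    rw [hd₀]
    refine eq_of_subtypeDomain_eq_of_degree_eq i₀ ?_ (by rw [hdegd d, Finsupp.degree_single])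
    ext ⟨i, hi⟩
    rw [Finsupp.subtypeDomain_apply, Finsupp.subtypeDomain_apply, Finsupp.single_apply, if_neg (Ne.symm hi)]
    have h1 := degree_eq_degree_subtypeDomain_add i₀ d.1
    rw [hdegd d, hd] at h1
    have h0 : (d.1.subtypeDomain fun i => i ≠ i₀).degree = 0 := by omega
    rw [Finsupp.degree_eq_zero_iff] at h0
    have := congrArg (fun f => f ⟨i, hi⟩) h0
    simpa only [Finsupp.subtypeDomain_apply, Finsupp.coe_zero, Pi.zero_apply] using this
  -- induction on the degree
  induction D generalizing F with
  | zero =>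
    -- a nonzero `F` would be a nonzero constant, which the bouquet with no petals excludes
    by_cases hF0 : F = 0
    · rw [hF0]; exact dvd_zero _
    · exfalso
      obtain ⟨s, hs⟩ := support_nonempty.mpr hF0
      have hs0 : s = 0 := (Finsupp.degree_eq_zero_iff s).mp (hdeg s hs)
      have hhom : F.IsHomogeneous 0 := fun u hu => by
        have := hdeg u (mem_support_iff.mpr hu)
        rw [Finsupp.degree_eq_weight_one] at this
        exact this
      refine not_mem_orbitVanishingIdeal_detFormLex_of_bouquet i₀ hhom hs ?_ hI
      rw [hs0, Finsupp.support_zero, Finset.sum_empty]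
      omega
  | succ D ih =>
    by_cases hexp : D + 1 + m - b = 0
    · rw [hexp, pow_zero]; exact one_dvd _
    -- every monomial of `F` is divisible by `X_{d₀}`
    have hdiv : ∀ s ∈ F.support, s d₀ ≠ 0 := by
      intro s hs hs0
      have hhom : F.IsHomogeneous (D + 1) := fun u hu => by
        have := hdeg u (mem_support_iff.mpr hu)
        rw [Finsupp.degree_eq_weight_one] at this
        exact this
      refine not_mem_orbitVanishingIdeal_detFormLex_of_bouquet i₀ hhom hs ?_ hI
      -- the budget of a monomial without `X_{d₀}`: `1 + b - (D + 1) ≤ m`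
      have hlt : ∀ d ∈ s.support, d.1 i₀ < m := by
        intro d hd
        rcases (hle d).lt_or_eq with h | h
        · exact h
        · exact absurd (Finsupp.mem_support_iff.mp hd) (by rw [htop d h]; exact not_not.mpr hs0)
      have h1 : ∑ d ∈ s.support, (m - d.1 i₀ - 1) ≤ ∑ d ∈ s.support, (s d * (m - d.1 i₀) - s d) := by
        refine Finset.sum_le_sum fun d hd => ?_
        have hsd : 1 ≤ s d := Nat.one_le_iff_ne_zero.mpr (Finsupp.mem_support_iff.mp hd)
        have := hlt d hd
        rw [← Nat.mul_sub_one]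
        exact Nat.le_mul_of_pos_left _ hsd
      have h2 : ∑ d ∈ s.support, (s d * (m - d.1 i₀) - s d) =
          ∑ d ∈ s.support, s d * (m - d.1 i₀) - ∑ d ∈ s.support, s d :=
        Finset.sum_tsub_distrib _ fun d hd => by
          have := hlt d hd
          exact Nat.le_mul_of_pos_right _ (by omega)
      have h3 : ∑ d ∈ s.support, s d * (m - d.1 i₀) = b := hbody s hs
      have h4 : ∑ d ∈ s.support, s d = D + 1 := by rw [← Finsupp.degree_apply]; exact hdeg s hs
      rw [h2, h3, h4] at h1
      omega
    -- divide by `X_{d₀}`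
    set F' : MvPolynomial (DegIdx (MatIdx m) m) k := F.divMonomial (Finsupp.single d₀ 1) with hF'
    have hmod : F.modMonomial (Finsupp.single d₀ 1) = 0 := by
      ext s
      rw [coeff_zero]
      by_cases h : Finsupp.single d₀ 1 ≤ s
      · exact coeff_modMonomial_of_le _ h
      · rw [coeff_modMonomial_of_not_le _ h]
        by_contra hne
        apply h
        rw [Finsupp.single_le_iff]
        exact Nat.one_le_iff_ne_zero.mpr (hdiv s (mem_support_iff.mpr hne))
    have hFF' : F = X d₀ * F' := by
      have := F.divMonomial_add_modMonomial_single d₀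
      rw [hmod, add_zero] at this
      exact this.symm
    -- the quotient is an equation of bidegree `(D, b)`
    have hF'I : F' ∈ orbitVanishingIdeal (detFormLex k m) m := by
      rcases (orbitVanishingIdeal_isPrime (detFormLex k m) m).mem_or_mem (hFF' ▸ hI) with h | h
      · exact absurd h (X_single_not_mem_orbitVanishingIdeal_detFormLex i₀ d₀ hd₀)
      · exact h
    have hsupp' : ∀ s' ∈ F'.support, Finsupp.single d₀ 1 + s' ∈ F.support := by
      intro s' hs'
      rw [mem_support_iff] at hs' ⊢
      rwa [hF', coeff_divMonomial] at hs'
    have hdeg' : ∀ s' ∈ F'.support, s'.degree = D := by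
      intro s' hs'
      have := hdeg _ (hsupp' s' hs')
      rw [map_add, Finsupp.degree_single] at this
      omega
    have hbody' : ∀ s' ∈ F'.support, (s'.sum fun d n => n * (m - d.1 i₀)) = b := by
      intro s' hs'
      have := hbody _ (hsupp' s' hs')
      rw [bq_bodySum_add, Finsupp.sum_single_index (zero_mul _), hd₀, Finsupp.single_eq_same,
        Nat.sub_self, mul_zero, zero_add] at this
      exact this
    have hdvd := ih F' hdeg' hbody' hF'I
    have hexp' : D + 1 + m - b = (D + m - b) + 1 := by omega
    rw [hexp', pow_succ, hFF', mul_comm (X d₀) F']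
    exact mul_dvd_mul hdvd dvd_rfl

/-- **Stability of the equation count of `Det_m` in the top-coordinate direction.**  Let `iₘ` be the
top letter, `w₀ = -m ε_{iₘ}` the weight of the highest-weight vector `X_{d₀}` (`d₀ = m·e_{iₘ}`,
`X_mem_highestWeightSpace_coordRep`), and let `χ` be a weight of degree `D` (`|χ| = -mD`) and body
`b = mD + χ iₘ` with `b + 1 ≤ D + m`.  Then multiplication by `X_{d₀}` is a linear bijection from the
highest-weight equations of `Δ(det_m)` of weight `χ - w₀` onto those of weight `χ` (injective since
`k[Sym^m]` is a domain; surjective by `X_pow_dvd_of_mem_orbitVanishingIdeal_detFormLex`, primality, and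
cancellation of the highest-weight factor `mem_highestWeightSpace_of_mul`), so the two spaces have the
same dimension. [new] -/
theorem finrank_equations_detFormLex_eq_of_le {k : Type*} [Field k] [CharZero k] {m : ℕ}
    (iₘ : MatIdx m) (hiₘ : ∀ i, i ≤ iₘ) (χ : Weight (MatIdx m)) (D b : ℕ)
    (hD : χ.size = -((m * D : ℕ) : ℤ)) (hb : ((m * D : ℕ) : ℤ) + χ iₘ = b) (hle : b + 1 ≤ D + m) :
    Module.finrank k ↥(highestWeightSpace (coordRep (MatIdx m) k m) χ ⊓
        (orbitVanishingIdeal (detFormLex k m) m).restrictScalars k) =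
      Module.finrank k ↥(highestWeightSpace (coordRep (MatIdx m) k m) (χ - Pi.single iₘ (-(m : ℤ))) ⊓
        (orbitVanishingIdeal (detFormLex k m) m).restrictScalars k) := by
  classical
  have hm : 0 < m := Fin.pos (ofLex iₘ).1
  set d₀ : DegIdx (MatIdx m) m := ⟨Finsupp.single iₘ m, mem_degMonomials_iff.mpr (Finsupp.degree_single _ _)⟩
    with hd₀
  have hX : (X d₀ : MvPolynomial (DegIdx (MatIdx m) m) k) ∈
      highestWeightSpace (coordRep (MatIdx m) k m) (Pi.single iₘ (-(m : ℤ))) :=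
    X_mem_highestWeightSpace_coordRep m iₘ hiₘ d₀ rfl
  have hX0 : (X d₀ : MvPolynomial (DegIdx (MatIdx m) m) k) ≠ 0 := X_ne_zero d₀
  set I : Ideal (MvPolynomial (DegIdx (MatIdx m) m) k) := orbitVanishingIdeal (detFormLex k m) m with hIdef
  set Eχ : Submodule k (MvPolynomial (DegIdx (MatIdx m) m) k) :=
    highestWeightSpace (coordRep (MatIdx m) k m) χ ⊓ I.restrictScalars k with hEχ
  set Eχ' : Submodule k (MvPolynomial (DegIdx (MatIdx m) m) k) :=
    highestWeightSpace (coordRep (MatIdx m) k m) (χ - Pi.single iₘ (-(m : ℤ))) ⊓ I.restrictScalars k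
    with hEχ'
  -- multiplication by `X_{d₀}` as a linear map `Eχ' → Eχ`
  have hmul_mem : ∀ G ∈ Eχ', X d₀ * G ∈ Eχ := by
    intro G hG
    refine ⟨?_, ?_⟩
    · have h := mul_mem_highestWeightSpace_coordRep hX hG.1
      rwa [add_sub_cancel] at h
    · exact I.mul_mem_left _ hG.2
  let L : Eχ' →ₗ[k] Eχ :=
    { toFun := fun G => ⟨X d₀ * G.1, hmul_mem G.1 G.2⟩
      map_add' := fun a c => by ext; simp [mul_add]
      map_smul' := fun c a => Subtype.ext (mul_smul_comm c (X d₀ : MvPolynomial (DegIdx (MatIdx m) m) k) a.1) }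
  have hLinj : Function.Injective L := by
    intro a c hac
    have h1 : X d₀ * a.1 = X d₀ * c.1 := congrArg Subtype.val hac
    exact Subtype.ext (mul_left_cancel₀ hX0 h1)
  have hLsurj : Function.Surjective L := by
    intro F
    have hFw : (F : MvPolynomial (DegIdx (MatIdx m) m) k) ∈ weightSpace (coordRep (MatIdx m) k m) χ :=
      highestWeightSpace_le_weightSpace _ _ F.2.1
    -- degrees and bodies of the monomials of `F`
    have hdegd : ∀ d : DegIdx (MatIdx m) m, d.1.degree = m := fun d => mem_degMonomials_iff.mp d.2
    have hle' : ∀ d : DegIdx (MatIdx m) m, d.1 iₘ ≤ m := fun d => by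
      have h1 := degree_eq_degree_subtypeDomain_add iₘ d.1
      have h2 := hdegd d
      omega
    have hw : ∀ s ∈ (F : MvPolynomial (DegIdx (MatIdx m) m) k).support, monWeight s = χ :=
      fun s hs => monWeight_eq_of_mem_weightSpace hFw hs
    have hdegs : ∀ s ∈ (F : MvPolynomial (DegIdx (MatIdx m) m) k).support, s.degree = D := by
      intro s hs
      have h1 := size_monWeight (σ := MatIdx m) s
      rw [hw s hs, hD, neg_inj, Nat.cast_inj] at h1
      exact (Nat.eq_of_mul_eq_mul_left hm h1).symm
    have hbodys : ∀ s ∈ (F : MvPolynomial (DegIdx (MatIdx m) m) k).support,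
        (s.sum fun d n => n * (m - d.1 iₘ)) = b := by
      intro s hs
      have key : ((∑ d ∈ s.support, s d * (m - d.1 iₘ) : ℕ) : ℤ) = ((m * D : ℕ) : ℤ) + χ iₘ := by
        rw [← hw s hs, monWeight_apply, ← hdegs s hs, Finsupp.degree_apply, Finset.mul_sum,
          Nat.cast_sum, Nat.cast_sum, Nat.cast_sum, ← sub_eq_add_neg, ← Finset.sum_sub_distrib]
        refine Finset.sum_congr rfl fun d _ => ?_
        rw [Nat.cast_mul, Nat.cast_sub (hle' d), Nat.cast_mul, Nat.cast_mul]
        ring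
      rw [hb] at key
      exact_mod_cast key
    have hdvd := X_pow_dvd_of_mem_orbitVanishingIdeal_detFormLex iₘ d₀ rfl b D F.1 hdegs hbodys F.2.2
    have hdvd1 : (X d₀ : MvPolynomial (DegIdx (MatIdx m) m) k) ∣ F.1 :=
      (dvd_pow_self _ (by omega)).trans hdvd
    obtain ⟨G, hG⟩ := hdvd1
    have hGI : G ∈ I := by
      rcases (orbitVanishingIdeal_isPrime (detFormLex k m) m).mem_or_mem (hG ▸ F.2.2) with h | h
      · exact absurd h (X_single_not_mem_orbitVanishingIdeal_detFormLex iₘ d₀ rfl)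
      · exact h
    have hGhw : G ∈ highestWeightSpace (coordRep (MatIdx m) k m) (χ - Pi.single iₘ (-(m : ℤ))) :=
      mem_highestWeightSpace_of_mul hX hX0 (hG ▸ F.2.1)
    exact ⟨⟨G, hGhw, hGI⟩, Subtype.ext hG.symm⟩
  haveI : FiniteDimensional k ↥(highestWeightSpace (coordRep (MatIdx m) k m) χ) :=
    finiteDimensional_highestWeightSpace_coordRep_holds hm.ne' χ
  haveI : FiniteDimensional k Eχ := Submodule.finiteDimensional_of_le inf_le_left
  exact (LinearEquiv.ofBijective L ⟨hLinj, hLsurj⟩).finrank_eq.symm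

/-- The equation count: `a(χ) = K_m(χ) + dim(HWV_χ ∩ I(Δ(det_m)))` (rank–nullity for the quotient map
on the highest-weight space of weight `χ`, complete reducibility). [folklore; method BLMW 2011 §5.2] -/
theorem plethysmCoeff_eq_orbitMultiplicity_add_finrank_equations {k : Type*} [Field k] [CharZero k]
    {m : ℕ} (hm : m ≠ 0) (χ : Weight (MatIdx m)) :
    plethysmCoeff k (MatIdx m) m χ = orbitMultiplicity k (detFormLex k m) m χ +
      Module.finrank k ↥(highestWeightSpace (coordRep (MatIdx m) k m) χ ⊓
        (orbitVanishingIdeal (detFormLex k m) m).restrictScalars k) := by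
  classical
  set V : Submodule k (MvPolynomial (DegIdx (MatIdx m) m) k) := highestWeightSpace (coordRep (MatIdx m) k m) χ
    with hV
  haveI : FiniteDimensional k V := finiteDimensional_highestWeightSpace_coordRep_holds hm χ
  let π : (coordRep (MatIdx m) k m).IntertwiningMap (orbitCoordRep (detFormLex k m) m) :=
    ⟨(Ideal.Quotient.mkₐ k (orbitVanishingIdeal (detFormLex k m) m)).toLinearMap,
      fun _ => LinearMap.ext fun _ => rfl⟩
  have hmap := map_highestWeightSpace_eq_of_surjective π (Ideal.Quotient.mkₐ_surjective k _)
    (isSemisimpleRepresentation_coordRep m) χ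
  have hr := LinearMap.finrank_range_add_finrank_ker (π.toLinearMap ∘ₗ V.subtype)
  rw [LinearMap.range_comp, Submodule.range_subtype] at hr
  have hker : LinearMap.ker (π.toLinearMap ∘ₗ V.subtype) =
      Submodule.comap V.subtype (V ⊓ (orbitVanishingIdeal (detFormLex k m) m).restrictScalars k) := by
    ext F
    rw [LinearMap.mem_ker, LinearMap.comp_apply, Submodule.mem_comap, Submodule.subtype_apply,
      Submodule.mem_inf]
    constructor
    · intro hF
      exact ⟨F.2, Ideal.Quotient.eq_zero_iff_mem.mp hF⟩
    · rintro ⟨-, hF⟩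
      exact Ideal.Quotient.eq_zero_iff_mem.mpr hF
  rw [hker, LinearEquiv.finrank_eq (Submodule.comapSubtypeEquivOfLe
    (inf_le_left : V ⊓ (orbitVanishingIdeal (detFormLex k m) m).restrictScalars k ≤ V))] at hr
  unfold orbitMultiplicity plethysmCoeff hwMultiplicity
  rw [← hmap]
  exact hr.symm

/-- **The equation count of `Det_m` is constant in the top-coordinate direction from degree `b - m` on.**
With `iₘ` the top letter and `w₀ = -m ε_{iₘ}`: for a weight `χ` of degree `D ≥ 1` (`|χ| = -mD`) and
body `b = mD + χ iₘ` with `b + 1 ≤ D + m`,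
`plethysmCoeff χ - K_m(χ) = plethysmCoeff (χ - w₀) - K_m(χ - w₀)`, i.e.
`a_{(λ₁; λ̄)}(δ[m]) - K_m((λ₁; λ̄)*) = a_{(λ₁ - m; λ̄)}((δ-1)[m]) - K_m((λ₁ - m; λ̄)*)` whenever
`δ ≥ |λ̄| - m + 1`: all equations of `Det_m` of body `|λ̄|` are born in degree `≤ |λ̄| - m`.
Registered sub-goal of the crux (wall-breaker k7, axis D). [new] -/
theorem plethysmCoeff_sub_orbitMultiplicity_detFormLex_eq {k : Type*} [Field k] [CharZero k] {m : ℕ}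
    (iₘ : MatIdx m) (hiₘ : ∀ i, i ≤ iₘ) (χ : Weight (MatIdx m)) (D b : ℕ)
    (hD : χ.size = -((m * D : ℕ) : ℤ)) (hb : ((m * D : ℕ) : ℤ) + χ iₘ = b) (hle : b + 1 ≤ D + m) :
    plethysmCoeff k (MatIdx m) m χ - orbitMultiplicity k (detFormLex k m) m χ =
      plethysmCoeff k (MatIdx m) m (χ - Pi.single iₘ (-(m : ℤ))) -
        orbitMultiplicity k (detFormLex k m) m (χ - Pi.single iₘ (-(m : ℤ))) := by
  have hm : m ≠ 0 := (Fin.pos (ofLex iₘ).1).ne'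
  have h1 := plethysmCoeff_eq_orbitMultiplicity_add_finrank_equations (k := k) hm χ
  have h2 := plethysmCoeff_eq_orbitMultiplicity_add_finrank_equations (k := k) hm
    (χ - Pi.single iₘ (-(m : ℤ)))
  have h3 := finrank_equations_detFormLex_eq_of_le (k := k) iₘ hiₘ χ D b hD hb hle
  omega

end

end Summit.ValiantsHypothesis.ValiantsHypothesis.Theorems.ValuativeFlip
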